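import Literature.NumberTheory.Automorphic.GKModulesSmoothVectorsProofs
import Literature.NumberTheory.Automorphic.GKModulesProofs
import Literature.NumberTheory.Automorphic.AutomorphicSpectrumProofs
import Mathlib.Analysis.InnerProductSpace.Calculus
import HarnessLib

/-!
# The archimedean `(𝔤, K)`-module of a discrete automorphic representation

Topic `NumberTheory/Automorphic`; namespace `Literature.NumberTheory.Automorphic` (dot notation on
`DiscreteAutomorphicRep`).  DEFINITIONS WITH BODIES + their unfolding / structural lemmas, all proved; no named
fact, no instance, no notation, no `sorry` (cell hodgecm-mathlib FLOOR 0, item D4 of the P3 integrator's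
ENGINE-INTERFACES §7 / §7c: «the `(𝔤, K)`-module of `P` at `ι` — ONE currency for P2a / P4a / P3b»).

Let `𝒢` be an adelic group datum over a number field `K` with automorphic measure `μ`
(`AdelicGroupData`, `[𝒢.IsAutomorphicMeasure μ]`), `P : DiscreteAutomorphicRep 𝒢 μ` a discrete automorphic
representation (an irreducible closed invariant subspace `P.space` of `L²(G(𝔸_K) ⧸ A_G G(K), μ)`,
`AutomorphicSpectrum`), and let `G : RealMatrixGroup A N` be a linear real group (`RealMatrixGroups`) mapped into
`G(𝔸_K)` by a continuous homomorphism `ιG : G →* 𝒢.Adelic` — in the applications the inclusion of ONE archimedean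
factor `G = G_ι ↪ G(F ⊗ ℝ) ↪ G(𝔸_F)` (e.g. ★ `UnitaryGroup.archSectionU21CM`).  Following Borel–Jacquet, §4.3–4.6
(an automorphic representation is a `(𝔤, K_∞) × G(𝔸_f)`-module; the archimedean component of `π ≅ π_∞ ⊗ π_f`) and
Borel–Wallach, Ch. 0 §2.4–2.6 (`V₀ = V^∞ ∩ V_(K)` of a continuous representation is a `(𝔤, K)`-module, unitary if
`V` is), this file defines

* §1 `P.archRep G ιG` — the restriction of `P` (the representation `P.space.toContRep` of `G(𝔸_K)` on the Hilbert
  space `P.space`) to `G` along `ιG` (Mathlib `ContRepresentation.restrict`); it is unitary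
  (`isUnitary_archRep`) and, for `ιG` continuous, strongly continuous (`isStronglyContinuous_archRep`, from ★
  `isStronglyContinuous_rightRegular_holds`);
* §2 `P.archModule G ιG := harishChandraSpace G (P.archRep G ιG)` — the smooth `K`-finite vectors
  (`K = G.maximalCompact`; ★ `GKModules`), with the `K`-action `P.archRepK G ιG := harishChandraRepK …` and the
  derived `𝔤`-action `P.archRepLie G ιG hι := harishChandraRepLie …` (★ `GKModulesSmoothVectorsProofs`, the
  EXPLICIT differential `X · v = d/dt P(ιG (exp tX)) v |_{t=0}`; no choice); `isHarishChandraModuleOf_archModule`,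
  uniqueness `eq_archRepLie_of_isHarishChandraModuleOf`, and the `(𝔤, K)`-module axioms `isGKModule_archModule`
  (★ `isGKModule_harishChandra_holds`);
* §3 unitarity of the archimedean module: `inner_dπ_add_inner_dπ_eq_zero` (generic: for a unitary representation
  `ϖ` of `G` on a Hilbert space, `⟪dϖ(X) v, w⟫ + ⟪v, dϖ(X) w⟫ = 0` for smooth `v, w` — Borel–Wallach 0 §2.5/2.6) and
  its instance `inner_archRepLie_add_inner_archRepLie_eq_zero`; `archModule` is stable under `P.archRep G ιG k`
  for `k ∈ K` and its smooth part under all of `G`.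

What this file does NOT say (honest scope).  `P.archModule G ιG` is the Harish-Chandra module of the restriction
of ALL of `P` to `G`; for `P ≅ π_ι ⊗ (⊗'_{v ≠ ι} π_v)` it is `π_ι`-ISOTYPIC (a sum of copies of the
Harish-Chandra module of `π_ι`), in general neither irreducible nor admissible.  The isotypy / tensor-product
statements [Flath 1979, Thm. 3–4; Borel–Jacquet §4.3–4.6] are separate named facts (items F1a/F1b of the same
brief), not asserted here.

## References

* A. Borel, H. Jacquet, *Automorphic forms and automorphic representations*, Proc. Sympos. Pure Math. 33.1
  (1979), §4.3–4.6 [BorelJacquetCorvallis1979].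
* A. Borel, N. Wallach, *Continuous Cohomology, Discrete Subgroups, and Representations of Reductive Groups*,
  2nd ed., AMS 2000, Ch. 0 §2.4–2.6 (pp. 3–4) [BorelWallach2000].
* N. R. Wallach, *Real Reductive Groups I* (1988), §1.6, §3.3.3–3.3.4 [WallachRRG1].
* Harish-Chandra, *Representations of a semisimple Lie group on a Banach space. I*, Trans. AMS 75 (1953), §9
  [HarishChandra1953].
-/

-- Mathlib idiom (Mathlib/Algebra/Lie/OfAssociative.lean; as in ★ `GKModules` and every `(𝔤, K)` file of the tree):
-- the commutator bracket on `Matrix N N A` and on `Module.End ℂ V`, needed to MENTION `G.lie →ₗ⁅ℝ⁆ Module.End ℂ _`.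
attribute [local instance 100] LieRing.ofAssociativeRing

open scoped MatrixGroups InnerProductSpace
open MeasureTheory

noncomputable section

namespace Literature.NumberTheory.Automorphic

universe u

/-! ## §0 Generic: the differential of a unitary representation is skew-Hermitian on smooth vectors -/

section SkewHermitian

variable {A : Type*} [NormedCommRing A] [NormedAlgebra ℝ A] [NormedAlgebra ℚ A] [CompleteSpace A]
  [StarRing A] {N : Type*} [Fintype N] [DecidableEq N] (G : RealMatrixGroup A N)

/-- `exp (0 · X) = 1` in `G` (a local copy of the three-line lemma used throughout the automorphic files).
[folklore] -/
private theorem expMem_zero_smul' (X : G.lie) : G.expMem ((0 : ℝ) • X) = 1 := by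
  refine Subtype.ext (Units.ext ?_)
  simp only [RealMatrixGroup.coe_expMem, coe_expGL, zero_smul, ZeroMemClass.coe_zero, NormedSpace.exp_zero,
    Subgroup.coe_one, Units.val_one]

variable {E : Type*} [NormedAddCommGroup E] [InnerProductSpace ℂ E] [CompleteSpace E]
  (ϖ : ContRepresentation ℂ G.carrier E)

/-- **The differential of a unitary representation is skew-Hermitian on smooth vectors**: for `ϖ` unitary and
`v, w` smooth vectors, `⟪dϖ(X) v, w⟫ + ⟪v, dϖ(X) w⟫ = 0` for every `X ∈ 𝔤` — differentiate the constant
function `t ↦ ⟪ϖ(exp tX) v, ϖ(exp tX) w⟫ = ⟪v, w⟫` at `t = 0` (`dϖ(X) u = d/dt ϖ(exp tX) u |_{t=0}`, ★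
`hasDerivAt_dπ`).  Borel–Wallach, Ch. 0 §2.5 («`(π(x)v, w) + (v, π(x)·w) = 0`») and §2.6 («`V₀` is unitary if
`(π, V)` is so»), pp. 3–4. [cite: BorelWallach2000, Ch. 0 §2.5–2.6 (pp. 3–4)] -/
theorem inner_dπ_add_inner_dπ_eq_zero (hU : ϖ.IsUnitary) {v w : E} (hv : v ∈ smoothVectors G ϖ)
    (hw : w ∈ smoothVectors G ϖ) (X : G.lie) :
    ⟪dπ G ϖ v X, w⟫_ℂ + ⟪v, dπ G ϖ w X⟫_ℂ = 0 := by
  have h1 := hasDerivAt_dπ G ϖ (differentiableAt_of_mem_smoothVectors G ϖ hv) X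
  have h2 := hasDerivAt_dπ G ϖ (differentiableAt_of_mem_smoothVectors G ϖ hw) X
  have h := h1.inner ℂ h2
  have hconst : (fun t : ℝ => ⟪ϖ (G.expMem (t • X)) v, ϖ (G.expMem (t • X)) w⟫_ℂ) = fun _ => ⟪v, w⟫_ℂ := by
    funext t
    exact hU.inner_map_map _ v w
  rw [hconst] at h
  have h0 := h.unique (hasDerivAt_const (0 : ℝ) ⟪v, w⟫_ℂ)
  rw [expMem_zero_smul', map_one, one_apply_eq_self, one_apply_eq_self] at h0
  rwa [add_comm] at h0

/-- The same in the form `⟪dϖ(X) v, w⟫ = -⟪v, dϖ(X) w⟫`. [cite: BorelWallach2000, Ch. 0 §2.5–2.6 (pp. 3–4)] -/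
theorem inner_dπ_left_eq_neg (hU : ϖ.IsUnitary) {v w : E} (hv : v ∈ smoothVectors G ϖ)
    (hw : w ∈ smoothVectors G ϖ) (X : G.lie) :
    ⟪dπ G ϖ v X, w⟫_ℂ = -⟪v, dπ G ϖ w X⟫_ℂ :=
  eq_neg_of_add_eq_zero_left (inner_dπ_add_inner_dπ_eq_zero G ϖ hU hv hw X)

/-- In particular `Re ⟪dϖ(X) v, v⟫ = 0` for a smooth vector `v` of a unitary representation (`dϖ(X)` is
skew-Hermitian). [cite: BorelWallach2000, Ch. 0 §2.5–2.6 (pp. 3–4)] -/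
theorem re_inner_dπ_self_eq_zero (hU : ϖ.IsUnitary) {v : E} (hv : v ∈ smoothVectors G ϖ) (X : G.lie) :
    (⟪dπ G ϖ v X, v⟫_ℂ).re = 0 := by
  have h := congrArg Complex.re (inner_dπ_add_inner_dπ_eq_zero G ϖ hU hv hv X)
  rw [Complex.add_re, ← inner_conj_symm v (dπ G ϖ v X), Complex.conj_re, Complex.zero_re] at h
  linarith

end SkewHermitian

/-! ## §1 The restriction of a discrete automorphic representation to an archimedean group -/

section ArchRep

variable {K : Type} [Field K] [NumberField K] {𝒢 : AdelicGroupData.{u} K}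
  {μ : Measure 𝒢.automorphicQuotient} [𝒢.IsAutomorphicMeasure μ]
  {A : Type*} [NormedCommRing A] [NormedAlgebra ℝ A] [NormedAlgebra ℚ A] [CompleteSpace A]
  [StarRing A] {N : Type*} [Fintype N] [DecidableEq N]
  (P : DiscreteAutomorphicRep 𝒢 μ) (G : RealMatrixGroup A N) (ιG : G.carrier →* 𝒢.Adelic)

/-- **`P.archRep G ιG` — the restriction of the discrete automorphic representation `P` to the linear real group
`G` along `ιG : G →* G(𝔸_K)`**: the representation `g ↦ R(ιG g)|_P` of `G` on the Hilbert space `P.space ≤ L²`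
(Mathlib `ContRepresentation.restrict` of `P.space.toContRep`).  For `ιG` the inclusion of the archimedean factor
at one place this is `P|_{G_ι}`, whose smooth `K_ι`-finite vectors form the archimedean `(𝔤, K)`-module of `P`
(§2).  Borel–Jacquet, §4.3 (the action of `G_∞` on automorphic forms) and §4.6.
[cite: BorelJacquetCorvallis1979, §4.3 and §4.6] -/
def DiscreteAutomorphicRep.archRep : ContRepresentation ℂ G.carrier P.space.toSubmodule :=
  P.space.toContRep.restrict ιG

/-- `P.archRep G ιG g v = R(ιG g) v` in `L²`. [cite: BorelJacquetCorvallis1979, §4.3 and §4.6] -/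
@[simp]
theorem DiscreteAutomorphicRep.coe_archRep_apply (g : G.carrier) (v : P.space.toSubmodule) :
    ((P.archRep G ιG g v : P.space.toSubmodule) : 𝒢.L2 μ) = 𝒢.rightRegular μ (ιG g) (v : 𝒢.L2 μ) := rfl

/-- `P.archRep G ιG g = P.space.toContRep (ιG g)`. [cite: BorelJacquetCorvallis1979, §4.3 and §4.6] -/
theorem DiscreteAutomorphicRep.archRep_apply (g : G.carrier) :
    P.archRep G ιG g = P.space.toContRep (ιG g) := rfl

/-- `P.archRep G ιG` is unitary (the regular representation is unitary, ★ `isUnitary_rightRegular`, and `P.space`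
is a closed invariant subspace). [cite: BorelJacquetCorvallis1979, §4.6] -/
theorem DiscreteAutomorphicRep.isUnitary_archRep : (P.archRep G ιG).IsUnitary := by
  intro g
  have hu : IsUnit (P.archRep G ιG g) := (Group.isUnit g).map (P.archRep G ιG).toMonoidHom
  refine hu.mem_unitary_of_star_mul_self
    ((P.archRep G ιG g).norm_map_iff_adjoint_comp_self.mp fun x => ?_)
  change ‖((𝒢.rightRegular μ (ιG g) (x : 𝒢.L2 μ)) : 𝒢.L2 μ)‖ = ‖(x : 𝒢.L2 μ)‖
  exact (𝒢.isUnitary_rightRegular μ).norm_map (ιG g) (x : 𝒢.L2 μ)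

/-- `P.archRep G ιG` is strongly continuous when `ιG` is continuous (strong continuity of the regular
representation, ★ `isStronglyContinuous_rightRegular_holds`). [cite: BorelJacquetCorvallis1979, §4.6] -/
theorem DiscreteAutomorphicRep.isStronglyContinuous_archRep (hι : Continuous ιG) :
    (P.archRep G ιG).IsStronglyContinuous := fun v => by
  refine Continuous.subtype_mk ?_ _
  exact ((𝒢.isStronglyContinuous_rightRegular_holds μ) (v : 𝒢.L2 μ)).comp hι

/-- `‖P.archRep G ιG g v‖ = ‖v‖`. [cite: BorelJacquetCorvallis1979, §4.6] -/
theorem DiscreteAutomorphicRep.norm_archRep_apply (g : G.carrier) (v : P.space.toSubmodule) :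
    ‖P.archRep G ιG g v‖ = ‖v‖ :=
  (P.isUnitary_archRep G ιG).norm_map g v

end ArchRep

/-! ## §2 The archimedean `(𝔤, K)`-module `P.archModule G ιG` -/

section ArchModule

variable {K : Type} [Field K] [NumberField K] {𝒢 : AdelicGroupData.{u} K}
  {μ : Measure 𝒢.automorphicQuotient} [𝒢.IsAutomorphicMeasure μ]
  {A : Type*} [NormedCommRing A] [NormedAlgebra ℝ A] [NormedAlgebra ℚ A] [CompleteSpace A]
  [StarRing A] {N : Type*} [Fintype N] [DecidableEq N]
  (P : DiscreteAutomorphicRep 𝒢 μ) (G : RealMatrixGroup A N) (ιG : G.carrier →* 𝒢.Adelic)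

/-- **`P.archModule G ιG` — the archimedean `(𝔤, K)`-module of `P` along `ιG`**: the Harish-Chandra space
`H_K^∞ = H^∞ ∩ H_K` of smooth `K`-finite vectors (`K = G.maximalCompact`) of the restriction `P.archRep G ιG` of
`P` to `G`, a complex subspace of `P.space` (★ `harishChandraSpace`).  Borel–Wallach, Ch. 0 §2.4
(`V₀ = V^∞ ∩ V_(K)`); Borel–Jacquet, §4.3–4.6 (the `(𝔤, K_∞)`-module of `K_∞`-finite smooth vectors of an
automorphic representation).  For `ιG` the archimedean factor at ONE place this module is `π_ι`-isotypic, not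
irreducible (module docstring). [cite: BorelWallach2000, Ch. 0 §2.4 and §2.6 (pp. 3–4)]
[cite: BorelJacquetCorvallis1979, §4.3 and §4.6] -/
def DiscreteAutomorphicRep.archModule : Submodule ℂ P.space.toSubmodule :=
  harishChandraSpace G (P.archRep G ιG)

/-- Unfolding: `P.archModule G ιG = harishChandraSpace G (P.archRep G ιG)`.
[cite: BorelWallach2000, Ch. 0 §2.4 (p. 3)] -/
theorem DiscreteAutomorphicRep.archModule_eq :
    P.archModule G ιG = harishChandraSpace G (P.archRep G ιG) := rfl

/-- Membership in the archimedean module: `v` is a smooth vector (`X ↦ R(ιG (exp X)) v` is smooth on `𝔤`) and a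
`K`-finite vector (its `K`-orbit spans a finite-dimensional subspace) of `P|_G`.
[cite: BorelWallach2000, Ch. 0 §2.4 (p. 3)] -/
theorem DiscreteAutomorphicRep.mem_archModule_iff (v : P.space.toSubmodule) :
    v ∈ P.archModule G ιG ↔
      v ∈ smoothVectors G (P.archRep G ιG) ∧ v ∈ kFiniteVectors G (P.archRep G ιG) :=
  Iff.rfl

/-- The archimedean module consists of smooth vectors. [cite: BorelWallach2000, Ch. 0 §2.4 (p. 3)] -/
theorem DiscreteAutomorphicRep.archModule_le_smoothVectors :
    P.archModule G ιG ≤ smoothVectors G (P.archRep G ιG) :=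
  inf_le_left

/-- The archimedean module consists of `K`-finite vectors. [cite: BorelWallach2000, Ch. 0 §2.4 (p. 3)] -/
theorem DiscreteAutomorphicRep.archModule_le_kFiniteVectors :
    P.archModule G ιG ≤ kFiniteVectors G (P.archRep G ιG) :=
  inf_le_right

/-- The archimedean module is `K`-stable. [cite: BorelWallach2000, Ch. 0 §2.4 (p. 3)] -/
theorem DiscreteAutomorphicRep.archRep_apply_mem_archModule (k : G.maximalCompact) {v : P.space.toSubmodule}
    (hv : v ∈ P.archModule G ιG) :
    P.archRep G ιG (Subgroup.inclusion G.maximalCompact_le_carrier k) v ∈ P.archModule G ιG :=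
  apply_mem_harishChandraSpace G (P.archRep G ιG) k hv

/-- The smooth vectors of `P|_G` are stable under all of `G`. [cite: WallachRRG1, §1.6.2] -/
theorem DiscreteAutomorphicRep.archRep_apply_mem_smoothVectors (g : G.carrier) {v : P.space.toSubmodule}
    (hv : v ∈ smoothVectors G (P.archRep G ιG)) :
    P.archRep G ιG g v ∈ smoothVectors G (P.archRep G ιG) :=
  apply_mem_smoothVectors G (P.archRep G ιG) g hv


/-! ### Smoothness and `K`-finiteness read in `L²`

The two defining conditions of `P.archModule G ιG` are conditions inside the Hilbert space `P.space`; for the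
junction with automorphic FORMS (whose `L²`-classes are produced in `L²` itself) we record that both can be
checked in the ambient `L² = 𝒢.L2 μ`. -/

/-- A map into the closed subspace `P.space ≤ L²` is `C^n` iff it is `C^n` as a map into `L²` (`P.space` is the
range of the orthogonal projection, a continuous linear map). [folklore] -/
private theorem DiscreteAutomorphicRep.contDiff_iff_contDiff_coe {X : Type*} [NormedAddCommGroup X] [NormedSpace ℝ X]
    {n : WithTop ℕ∞} {f : X → P.space.toSubmodule} :
    ContDiff ℝ n f ↔ ContDiff ℝ n fun x => (f x : 𝒢.L2 μ) := by
  refine ⟨fun h => ((P.space.toSubmodule.subtypeL).restrictScalars ℝ).contDiff.comp h, fun h => ?_⟩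
  have hf : f = fun x => P.space.toSubmodule.orthogonalProjectionOnto (f x : 𝒢.L2 μ) := by
    funext x
    exact (Submodule.orthogonalProjectionOnto_mem_subspace_eq_self (f x)).symm
  rw [hf]
  exact ((P.space.toSubmodule.orthogonalProjectionOnto).restrictScalars ℝ).contDiff.comp h

open scoped ContDiff Matrix.Norms.Operator in
/-- **Smoothness read in `L²`**: `v ∈ P.space` is a smooth vector of `P|_G` iff
`X ↦ R(ιG (exp X)) v` is a smooth map `𝔤 → L²`. [cite: BorelWallach2000, Ch. 0 §2.4 (p. 3)] -/
theorem DiscreteAutomorphicRep.mem_smoothVectors_archRep_iff (v : P.space.toSubmodule) :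
    v ∈ smoothVectors G (P.archRep G ιG) ↔
      ContDiff ℝ ∞ fun X : G.lie.toSubmodule => 𝒢.rightRegular μ (ιG (G.expMem ⟨X, X.2⟩)) (v : 𝒢.L2 μ) := by
  rw [mem_smoothVectors_iff]
  exact P.contDiff_iff_contDiff_coe

/-- The `K`-orbit span of `v ∈ P.space` for `P|_G`, pushed into `L²`, is the span of the `K`-orbit
`{R(ιG k) v}` in `L²`. [folklore] -/
private theorem DiscreteAutomorphicRep.map_subtype_kOrbitSpan (v : P.space.toSubmodule) :
    (kOrbitSpan G (P.archRep G ιG) v).map P.space.toSubmodule.subtype =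
      Submodule.span ℂ (Set.range fun k : G.maximalCompact =>
        𝒢.rightRegular μ (ιG (Subgroup.inclusion G.maximalCompact_le_carrier k)) (v : 𝒢.L2 μ)) := by
  rw [kOrbitSpan, Submodule.map_span, ← Set.range_comp]
  rfl

/-- **`K`-finiteness read in `L²`**: `v ∈ P.space` is a `K`-finite vector of `P|_G` iff the `K`-orbit
`{R(ιG k) v | k ∈ K}` spans a finite-dimensional subspace of `L²`. [cite: BorelWallach2000, Ch. 0 §2.4 (p. 3)] -/
theorem DiscreteAutomorphicRep.mem_kFiniteVectors_archRep_iff (v : P.space.toSubmodule) :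
    v ∈ kFiniteVectors G (P.archRep G ιG) ↔
      FiniteDimensional ℂ (Submodule.span ℂ (Set.range fun k : G.maximalCompact =>
        𝒢.rightRegular μ (ιG (Subgroup.inclusion G.maximalCompact_le_carrier k)) (v : 𝒢.L2 μ))) := by
  rw [mem_kFiniteVectors_iff, ← P.map_subtype_kOrbitSpan G ιG]
  refine ⟨fun h => inferInstance, fun h => ?_⟩
  exact Module.Finite.equiv
    (Submodule.equivMapOfInjective _ P.space.toSubmodule.injective_subtype (kOrbitSpan G (P.archRep G ιG) v)).symm

open scoped ContDiff Matrix.Norms.Operator in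
/-- **Membership in the archimedean module read in `L²`**: `v ∈ P.archModule G ιG` iff `X ↦ R(ιG (exp X)) v` is
smooth `𝔤 → L²` and the `K`-orbit of `v` spans a finite-dimensional subspace of `L²`.
[cite: BorelWallach2000, Ch. 0 §2.4 (p. 3)] [cite: BorelJacquetCorvallis1979, §4.3 and §4.6] -/
theorem DiscreteAutomorphicRep.mem_archModule_iff_coe (v : P.space.toSubmodule) :
    v ∈ P.archModule G ιG ↔
      (ContDiff ℝ ∞ fun X : G.lie.toSubmodule => 𝒢.rightRegular μ (ιG (G.expMem ⟨X, X.2⟩)) (v : 𝒢.L2 μ)) ∧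
        FiniteDimensional ℂ (Submodule.span ℂ (Set.range fun k : G.maximalCompact =>
          𝒢.rightRegular μ (ιG (Subgroup.inclusion G.maximalCompact_le_carrier k)) (v : 𝒢.L2 μ))) := by
  rw [mem_archModule_iff, mem_smoothVectors_archRep_iff, mem_kFiniteVectors_archRep_iff]

/-- **`P.archRepK G ιG` — the action of `K = G.maximalCompact` on the archimedean module**, by restriction of
`P.archRep G ιG` (★ `harishChandraRepK`). [cite: BorelWallach2000, Ch. 0 §2.4–2.6 (pp. 3–4)] -/
def DiscreteAutomorphicRep.archRepK : Representation ℂ G.maximalCompact (P.archModule G ιG) :=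
  harishChandraRepK G (P.archRep G ιG)

/-- Unfolding: `P.archRepK G ιG = harishChandraRepK G (P.archRep G ιG)`.
[cite: BorelWallach2000, Ch. 0 §2.4 (p. 3)] -/
theorem DiscreteAutomorphicRep.archRepK_eq : P.archRepK G ιG = harishChandraRepK G (P.archRep G ιG) := rfl

/-- `P.archRepK G ιG k v = R(ιG k) v` in `P.space`. [cite: BorelWallach2000, Ch. 0 §2.4 (p. 3)] -/
@[simp]
theorem DiscreteAutomorphicRep.coe_archRepK_apply (k : G.maximalCompact) (v : P.archModule G ιG) :
    ((P.archRepK G ιG k v : P.archModule G ιG) : P.space.toSubmodule) =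
      P.archRep G ιG (Subgroup.inclusion G.maximalCompact_le_carrier k) v :=
  rfl

/-- `K` acts isometrically on the archimedean module. [cite: BorelWallach2000, Ch. 0 §2.5 (pp. 3–4)] -/
theorem DiscreteAutomorphicRep.norm_archRepK_apply (k : G.maximalCompact) (v : P.archModule G ιG) :
    ‖((P.archRepK G ιG k v : P.archModule G ιG) : P.space.toSubmodule)‖ = ‖(v : P.space.toSubmodule)‖ :=
  P.norm_archRep_apply G ιG _ v

variable [FiniteDimensional ℝ A] (hι : Continuous ιG)

/-- **`P.archRepLie G ιG hι` — the derived action of `𝔤 = G.lie` on the archimedean module**: the real Lie algebra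
morphism `X ↦ (v ↦ d/dt R(ιG (exp tX)) v |_{t=0})` (★ `harishChandraRepLie`, the explicit differential; it needs
the strong continuity of `P.archRep G ιG`, i.e. `ιG` continuous).  Borel–Wallach, Ch. 0 §2.4 («`V₀` is stable under
`𝔤`») and §2.6; Harish-Chandra 1953, §9. [cite: BorelWallach2000, Ch. 0 §2.4 and §2.6 (pp. 3–4)]
[cite: HarishChandra1953, §9] -/
def DiscreteAutomorphicRep.archRepLie : G.lie →ₗ⁅ℝ⁆ Module.End ℂ (P.archModule G ιG) :=
  harishChandraRepLie G (P.archRep G ιG) (P.isStronglyContinuous_archRep G ιG hι)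

/-- Unfolding: `P.archRepLie G ιG hι = harishChandraRepLie G (P.archRep G ιG) _`.
[cite: BorelWallach2000, Ch. 0 §2.4 (p. 3)] -/
theorem DiscreteAutomorphicRep.archRepLie_eq :
    P.archRepLie G ιG hι = harishChandraRepLie G (P.archRep G ιG) (P.isStronglyContinuous_archRep G ιG hι) :=
  rfl

/-- `P.archRepLie G ιG hι X v = dπ(X) v` (★ `dπ` of `GKModulesSmoothVectorsProofs`) in `P.space`.
[cite: BorelWallach2000, Ch. 0 §2.4 (p. 3)] -/
@[simp]
theorem DiscreteAutomorphicRep.coe_archRepLie_apply (X : G.lie) (v : P.archModule G ιG) :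
    ((P.archRepLie G ιG hι X v : P.archModule G ιG) : P.space.toSubmodule) = dπ G (P.archRep G ιG) v X :=
  rfl

/-- **The archimedean module IS the Harish-Chandra module of `P|_G`**: `P.archModule G ιG` is the space of smooth
`K`-finite vectors and `P.archRepLie G ιG hι X v` is the derivative `d/dt R(ιG (exp tX)) v |_{t=0}` for all
`X ∈ 𝔤`, `v ∈ P.archModule G ιG` (★ `isHarishChandraModuleOf_harishChandraRepLie`).
[cite: BorelWallach2000, Ch. 0 §2.4 and §2.6 (pp. 3–4)] [cite: HarishChandra1953, §9] -/
theorem DiscreteAutomorphicRep.isHarishChandraModuleOf_archModule :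
    IsHarishChandraModuleOf G (P.archRep G ιG) (P.archModule G ιG) (P.archRepLie G ιG hι) :=
  isHarishChandraModuleOf_harishChandraRepLie G (P.archRep G ιG) (P.isStronglyContinuous_archRep G ιG hι)

/-- The derivative formula: `t ↦ R(ιG (exp tX)) v` has derivative `P.archRepLie G ιG hι X v` at `t = 0`, for
`v ∈ P.archModule G ιG`. [cite: BorelWallach2000, Ch. 0 §2.4 (p. 3)] [cite: HarishChandra1953, §9] -/
theorem DiscreteAutomorphicRep.hasDerivAt_archRepLie (X : G.lie) (v : P.archModule G ιG) :
    HasDerivAt (fun t : ℝ => P.archRep G ιG (G.expMem (t • X)) (v : P.space.toSubmodule))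
      ((P.archRepLie G ιG hι X v : P.archModule G ιG) : P.space.toSubmodule) 0 :=
  (P.isHarishChandraModuleOf_archModule G ιG hι).2 X v

/-- **Uniqueness of the `𝔤`-action**: any real Lie algebra action `ρ𝔤` on `P.archModule G ιG` satisfying the
derivative formula (`IsHarishChandraModuleOf`) IS `P.archRepLie G ιG hι` (uniqueness of derivatives, ★
`isHarishChandraModuleOf_unique`) — so the definition involves no choice.
[cite: WallachRRG1, §1.6.1 and §3.3.4] -/
theorem DiscreteAutomorphicRep.eq_archRepLie_of_isHarishChandraModuleOf
    {ρ𝔤 : G.lie →ₗ⁅ℝ⁆ Module.End ℂ (P.archModule G ιG)}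
    (h : IsHarishChandraModuleOf G (P.archRep G ιG) (P.archModule G ιG) ρ𝔤) :
    ρ𝔤 = P.archRepLie G ιG hι :=
  isHarishChandraModuleOf_unique G (P.archRep G ιG) h (P.isHarishChandraModuleOf_archModule G ιG hι)

/-- **The archimedean module is a `(𝔤, K)`-module**: `(P.archRepK G ιG, P.archRepLie G ιG hι)` satisfy the
`(𝔤, K)`-module axioms `IsGKModule` — every vector `K`-finite, `K` acting weakly continuously,
`ρK k ∘ ρ𝔤 X ∘ ρK k⁻¹ = ρ𝔤 (Ad k X)`, the weak derivative of `ρK` along `𝔨` equal to `ρ𝔤|𝔨` (★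
`isGKModule_harishChandra_holds`).  Borel–Wallach, Ch. 0 §2.6 («Let `(π, V) ∈ 𝒞_G`. Then `V₀` is a
`(𝔤, K)`-module»); Borel–Jacquet §4.6. [cite: BorelWallach2000, Ch. 0 §2.6 (pp. 3–4)]
[cite: BorelJacquetCorvallis1979, §4.6] -/
theorem DiscreteAutomorphicRep.isGKModule_archModule [StarModule ℝ A] [ContinuousStar A] :
    IsGKModule G (P.archRepK G ιG) (P.archRepLie G ιG hι) :=
  isGKModule_harishChandra_holds G (P.archRep G ιG) (P.isStronglyContinuous_archRep G ιG hι) (P.archRepK G ιG)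
    (fun _ _ => rfl) (P.isHarishChandraModuleOf_archModule G ιG hι)

/-! ### §3 Unitarity of the archimedean module -/

/-- **The archimedean module is unitary** (infinitesimally): for `v, w ∈ P.archModule G ιG` and `X ∈ 𝔤`,
`⟪X·v, w⟫ + ⟪v, X·w⟫ = 0` in the Hilbert space `P.space ≤ L²` (§0 applied to the unitary representation
`P.archRep G ιG`).  Borel–Wallach, Ch. 0 §2.5–2.6 («`V₀` … is unitary if `(π, V)` is so»).
[cite: BorelWallach2000, Ch. 0 §2.5–2.6 (pp. 3–4)] -/
theorem DiscreteAutomorphicRep.inner_archRepLie_add_inner_archRepLie_eq_zero (X : G.lie)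
    (v w : P.archModule G ιG) :
    ⟪((P.archRepLie G ιG hι X v : P.archModule G ιG) : P.space.toSubmodule), (w : P.space.toSubmodule)⟫_ℂ +
        ⟪(v : P.space.toSubmodule), ((P.archRepLie G ιG hι X w : P.archModule G ιG) : P.space.toSubmodule)⟫_ℂ =
      0 :=
  inner_dπ_add_inner_dπ_eq_zero G (P.archRep G ιG) (P.isUnitary_archRep G ιG) v.2.1 w.2.1 X

/-- `⟪X·v, w⟫ = -⟪v, X·w⟫` on the archimedean module. [cite: BorelWallach2000, Ch. 0 §2.5–2.6 (pp. 3–4)] -/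
theorem DiscreteAutomorphicRep.inner_archRepLie_left_eq_neg (X : G.lie) (v w : P.archModule G ιG) :
    ⟪((P.archRepLie G ιG hι X v : P.archModule G ιG) : P.space.toSubmodule), (w : P.space.toSubmodule)⟫_ℂ =
      -⟪(v : P.space.toSubmodule), ((P.archRepLie G ιG hι X w : P.archModule G ιG) : P.space.toSubmodule)⟫_ℂ :=
  inner_dπ_left_eq_neg G (P.archRep G ιG) (P.isUnitary_archRep G ιG) v.2.1 w.2.1 X

end ArchModule

end Literature.NumberTheory.Automorphic
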